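import Mathlib.Topology.EMetricSpace.BoundedVariation
import Mathlib.Analysis.Complex.Basic
import Mathlib.Topology.MetricSpace.Thickening
import Mathlib.MeasureTheory.Measure.Lebesgue.Basic
import Literature.Analysis.FunctionSpaces.BVLevelSetsLocal
import Literature.Probability.Percolation.StripPieces
import HarnessLib

/-!
# Preliminaries for the junction squares of the cut: generic radii and cut parameters

Topic `Probability/Percolation`.  Support file (definitions and proofs, no named fact) for the zone
geometry of the proof of Schramm–Smirnov's Prop. 4.1 (Ann. Probab. 39 (2011), §4), per-strip form.
Four elementary tools used to place the junction squares and the cut parameters of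
`StripPieces.PathCoreData`:

* `supDist` — the sup-norm distance on `ℂ`; the squares `coreSq`, `coreSqCl` are its open and closed
  balls and the frontier of an open square lies on the level set `{supDist · x = r}`
  (`frontier_coreSq_subset`);
* `exists_radius_finite_levelSets` — **generic radii**: for finitely many continuous paths of
  bounded variation on `[0, 1]` and finitely many centres there are arbitrarily small radii `r > 0`
  at which every path meets the boundary of every square at finitely many parameters (a.e. level
  set of a Lipschitz function of a BV path is finite, `ae_finite_levelSet_inter_of_isCompact`);
* `exists_forall_eVariationOn_Icc_le` — **uniformly small variation**: a continuous function of
  bounded variation on `[a, b]` has variation `≤ ε` on every short enough subinterval (Lebesgue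
  number of the cover given by `BoundedVariationOn.tendsto_eVariationOn_Icc_zero_left/right`);
* `exists_cut_params` — **cut parameters**: finitely many parameters `0, 1 ∈ CUT ⊆ [0, 1]`, the
  interior ones off a given finite set, consecutive ones at variation `≤ η`.

## References

* O. Schramm, S. Smirnov, Ann. Probab. 39 (2011), arXiv:1101.5820, §4, proof of Prop. 4.1 (the
  discs `B(x_i, s)` at the junction points, "approximating if necessary"). [SchrammSmirnov2011]
-/

noncomputable section

open Set Metric MeasureTheory Filter Topology
open Literature.Analysis.FunctionSpaces
open scoped ENNReal NNReal

namespace Literature.Probability.Percolation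

namespace StripPieces

/-! ### The sup-norm distance and the squares -/

/-- The sup-norm distance of two points of the plane. [folklore] -/
def supDist (w x : ℂ) : ℝ := max |w.re - x.re| |w.im - x.im|

/-- `supDist_nonneg` (supDist nonneg). [folklore] -/
theorem supDist_nonneg (w x : ℂ) : 0 ≤ supDist w x := le_max_of_le_left (abs_nonneg _)

/-- `supDist_comm` (supDist comm). [folklore] -/
theorem supDist_comm (w x : ℂ) : supDist w x = supDist x w := by
  rw [supDist, supDist, abs_sub_comm w.re, abs_sub_comm w.im]

/-- `supDist_self` (supDist self). [folklore] -/
theorem supDist_self (x : ℂ) : supDist x x = 0 := by simp [supDist]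

/-- The sup-norm distance is at most the Euclidean distance. [folklore] -/
theorem supDist_le_dist (w x : ℂ) : supDist w x ≤ dist w x := by
  rw [supDist, dist_eq_norm]
  exact max_le (by simpa using Complex.abs_re_le_norm (w - x)) (by simpa using Complex.abs_im_le_norm (w - x))

/-- The Euclidean distance is at most twice the sup-norm distance. [folklore] -/
theorem dist_le_two_mul_supDist (w x : ℂ) : dist w x ≤ 2 * supDist w x := by
  rw [dist_eq_norm]
  have h := Complex.norm_le_abs_re_add_abs_im (w - x)
  simp only [Complex.sub_re, Complex.sub_im] at h
  have h1 : |w.re - x.re| ≤ supDist w x := le_max_left _ _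
  have h2 : |w.im - x.im| ≤ supDist w x := le_max_right _ _
  linarith

/-- The sup-norm triangle inequality. [folklore] -/
theorem supDist_triangle (w x y : ℂ) : supDist w y ≤ supDist w x + supDist x y := by
  refine max_le ?_ ?_
  · calc |w.re - y.re| = |(w.re - x.re) + (x.re - y.re)| := by ring_nf
      _ ≤ |w.re - x.re| + |x.re - y.re| := abs_add_le _ _
      _ ≤ supDist w x + supDist x y := add_le_add (le_max_left _ _) (le_max_left _ _)
  · calc |w.im - y.im| = |(w.im - x.im) + (x.im - y.im)| := by ring_nf
      _ ≤ |w.im - x.im| + |x.im - y.im| := abs_add_le _ _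
      _ ≤ supDist w x + supDist x y := add_le_add (le_max_right _ _) (le_max_right _ _)

/-- `|supDist w x − supDist w' x| ≤ dist w w'`: the sup-norm distance to a point is `1`-Lipschitz.
[folklore] -/
theorem abs_supDist_sub_supDist_le (w w' x : ℂ) : |supDist w x - supDist w' x| ≤ dist w w' := by
  rw [abs_sub_le_iff]
  constructor
  · have := supDist_triangle w w' x
    have := supDist_le_dist w w'
    linarith
  · have := supDist_triangle w' w x
    have := supDist_le_dist w' w
    rw [dist_comm] at this
    linarith

/-- `lipschitzWith_supDist` (lipschitzWith supDist). [folklore] -/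
theorem lipschitzWith_supDist (x : ℂ) : LipschitzWith 1 fun w => supDist w x :=
  LipschitzWith.of_dist_le_mul fun w w' => by
    rw [NNReal.coe_one, one_mul, Real.dist_eq]
    exact abs_supDist_sub_supDist_le w w' x

/-- `continuous_supDist` (continuous supDist). [folklore] -/
theorem continuous_supDist (x : ℂ) : Continuous fun w => supDist w x :=
  (lipschitzWith_supDist x).continuous

/-- The open square is the open sup-norm ball. [folklore] -/
theorem mem_coreSq_iff {w x : ℂ} {r : ℝ} : w ∈ coreSq x r ↔ supDist w x < r := by
  simp [coreSq, supDist]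

/-- The closed square is the closed sup-norm ball. [folklore] -/
theorem mem_coreSqCl_iff {w x : ℂ} {r : ℝ} : w ∈ coreSqCl x r ↔ supDist w x ≤ r := by
  simp [coreSqCl, supDist]

/-- The centre lies in its open square. [folklore] -/
theorem self_mem_coreSq {x : ℂ} {r : ℝ} (hr : 0 < r) : x ∈ coreSq x r := by
  rw [mem_coreSq_iff, supDist_self]; exact hr

/-- **The frontier of an open square lies on the sup-norm sphere.** [folklore] -/
theorem frontier_coreSq_subset (x : ℂ) (r : ℝ) : frontier (coreSq x r) ⊆ {w | supDist w x = r} := by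
  intro w hw
  rw [frontier, (isOpen_coreSq x r).interior_eq] at hw
  obtain ⟨hcl, hno⟩ := hw
  have hle : supDist w x ≤ r := mem_coreSqCl_iff.1 (closure_coreSq_subset x r hcl)
  have hge : ¬ supDist w x < r := fun h => hno (mem_coreSq_iff.2 h)
  exact le_antisymm hle (not_lt.1 hge)

/-- The closed square is compact. [folklore] -/
theorem isCompact_coreSqCl (x : ℂ) (r : ℝ) : IsCompact (coreSqCl x r) := by
  refine Metric.isCompact_of_isClosed_isBounded (isClosed_coreSqCl x r) ?_
  refine (Metric.isBounded_closedBall (x := x) (r := 2 * |r|)).subset fun w hw => ?_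
  rw [mem_coreSqCl_iff] at hw
  rw [Metric.mem_closedBall]
  calc dist w x ≤ 2 * supDist w x := dist_le_two_mul_supDist w x
    _ ≤ 2 * |r| := by have := le_abs_self r; nlinarith [supDist_nonneg w x]

/-- Points of the closed square are within twice the half-width of the centre. [folklore] -/
theorem dist_le_of_mem_coreSqCl {w x : ℂ} {r : ℝ} (hw : w ∈ coreSqCl x r) : dist w x ≤ 2 * r :=
  (dist_le_two_mul_supDist w x).trans (by have := mem_coreSqCl_iff.1 hw; linarith)

/-! ### Separation of sets and of points -/

/-- **Disjoint compact and closed sets are uniformly separated** (vacuous for empty sets).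
[folklore] -/
theorem exists_pos_le_dist_of_disjoint {X : Type*} [PseudoMetricSpace X] {s t : Set X} (hs : IsCompact s)
    (ht : IsClosed t) (h : Disjoint s t) : ∃ m > 0, ∀ x ∈ s, ∀ y ∈ t, m ≤ dist x y := by
  obtain ⟨δ, hδ, hdis⟩ := h.exists_thickenings hs ht
  refine ⟨δ, hδ, fun x hx y hy => ?_⟩
  by_contra hlt
  push Not at hlt
  have h1 : y ∈ thickening δ s := Metric.mem_thickening_iff.2 ⟨x, hx, by rw [dist_comm]; exact hlt⟩
  have h2 : y ∈ thickening δ t := self_subset_thickening hδ t hy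
  exact Set.disjoint_left.1 hdis h1 h2

/-- **Distinct points of a finite set are uniformly separated.** [folklore] -/
theorem exists_pos_le_dist_finset {X : Type*} [MetricSpace X] (S : Finset X) :
    ∃ g > 0, ∀ x ∈ S, ∀ y ∈ S, x ≠ y → g ≤ dist x y := by
  classical
  induction S using Finset.induction_on with
  | empty => exact ⟨1, one_pos, by simp⟩
  | insert a S haS ih =>
    obtain ⟨g, hg, hS⟩ := ih
    -- the distances from the new point to the old ones
    obtain ⟨g', hg', ha⟩ : ∃ g' > 0, ∀ y ∈ S, g' ≤ dist a y := by
      by_cases hSe : S = ∅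
      · exact ⟨1, one_pos, by simp [hSe]⟩
      · obtain ⟨y₀, hy₀, hmin⟩ := S.exists_min_image (fun y => dist a y) (Finset.nonempty_iff_ne_empty.2 hSe)
        refine ⟨dist a y₀, dist_pos.2 (fun h => haS (h ▸ hy₀)), fun y hy => hmin y hy⟩
    refine ⟨min g g', lt_min hg hg', fun x hx y hy hxy => ?_⟩
    rcases Finset.mem_insert.1 hx with rfl | hxS
    · rcases Finset.mem_insert.1 hy with rfl | hyS
      · exact absurd rfl hxy
      · exact (min_le_right _ _).trans (ha y hyS)
    · rcases Finset.mem_insert.1 hy with rfl | hyS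
      · rw [dist_comm]; exact (min_le_right _ _).trans (ha x hxS)
      · exact (min_le_left _ _).trans (hS x hxS y hyS hxy)

/-! ### Generic radii -/

/-- **Generic radii.**  For finitely many continuous paths of bounded variation on `[0, 1]` and a
finite set of centres, below every positive bound there is a radius `r > 0` such that every path
meets the sup-norm sphere of radius `r` about every centre at finitely many parameters of `[0, 1]`
(so the frontier of every square `coreSq x r` is met finitely often, `frontier_coreSq_subset`).
[cite: SchrammSmirnov2011, §4, proof of Prop. 4.1 ("the intersection of α with ⋃ᵢ ∂B(xᵢ, s) is finite", by the area theorem)] -/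
theorem exists_radius_finite_levelSets {n : ℕ} (γ : Fin n → ℝ → ℂ) (hc : ∀ i, Continuous (γ i))
    (hbv : ∀ i, BoundedVariationOn (γ i) (Icc 0 1)) (X : Finset ℂ) {rmax : ℝ} (hr : 0 < rmax) :
    ∃ r, 0 < r ∧ r < rmax ∧ ∀ i, ∀ x ∈ X, {t : ℝ | t ∈ Icc (0 : ℝ) 1 ∧ supDist (γ i t) x = r}.Finite := by
  -- a.e. radius is good for every path and every centre
  have hae : ∀ᵐ s ∂(volume : Measure ℝ), ∀ i, ∀ x ∈ X, {t : ℝ | t ∈ Icc (0 : ℝ) 1 ∧ supDist (γ i t) x = s}.Finite := by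
    refine ae_all_iff.2 fun i => (eventually_all_finset X).2 fun x _ => ?_
    have hF : ∀ w ∈ (univ : Set ℂ), ∃ C : ℝ≥0, ∃ t ∈ 𝓝 w, LipschitzOnWith C (fun w => supDist w x) t :=
      fun w _ => ⟨1, univ, univ_mem, (lipschitzWith_supDist x).lipschitzOnWith⟩
    have h := ae_finite_levelSet_inter_of_isCompact (F := fun w => supDist w x) (γ := γ i) (T := Icc 0 1)
      isOpen_univ (hc i) (hbv i) hF isCompact_Icc Subset.rfl (mapsTo_univ _ _)
    filter_upwards [h] with s hs
    exact hs
  -- the bad radii are null, the interval `(0, rmax)` is not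
  by_contra hnone
  push Not at hnone
  have hsub : Ioo 0 rmax ⊆ {s | ¬ ∀ i, ∀ x ∈ X, {t : ℝ | t ∈ Icc (0 : ℝ) 1 ∧ supDist (γ i t) x = s}.Finite} :=
    fun s hs hall => by
      obtain ⟨i, x, hx, hinf⟩ := hnone s hs.1 hs.2
      exact hinf (hall i x hx)
  have hnull : (volume : Measure ℝ) (Ioo 0 rmax) = 0 := measure_mono_null hsub (ae_iff.1 hae)
  rw [Real.volume_Ioo, sub_zero, ENNReal.ofReal_eq_zero] at hnull
  linarith

/-! ### Uniformly small variation on short intervals -/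

/-- **Uniformly small variation**: a continuous function of bounded variation on `[a, b]` has
variation at most `ε` on every subinterval of length at most some `λ > 0`. [folklore] -/
theorem exists_forall_eVariationOn_Icc_le {E : Type*} [PseudoEMetricSpace E] {f : ℝ → E} {a b : ℝ}
    (hf : Continuous f) (hbv : BoundedVariationOn f (Icc a b)) {ε : ℝ≥0∞} (hε : 0 < ε) :
    ∃ l > 0, ∀ s t, s ∈ Icc a b → t ∈ Icc a b → s ≤ t → t - s ≤ l → eVariationOn f (Icc s t) ≤ ε := by
  have hε2 : 0 < ε / 2 := ENNReal.half_pos hε.ne'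
  -- around every point, short intervals on either side have variation `< ε / 2`
  have hloc : ∀ x ∈ Icc a b, ∃ τ > 0, ∀ y ∈ Icc a b, dist y x < τ →
      eVariationOn f (Icc a b ∩ Icc y x) < ε / 2 ∧ eVariationOn f (Icc a b ∩ Icc x y) < ε / 2 := by
    intro x hx
    have hl := hbv.tendsto_eVariationOn_Icc_zero_left (hf.continuousWithinAt (s := Icc a b ∩ Iic x) (x := x))
    have hr := hbv.tendsto_eVariationOn_Icc_zero_right x (hf.continuousWithinAt (s := Icc a b ∩ Ici x) (x := x))
    have hl' : ∀ᶠ y in 𝓝[Icc a b] x, eVariationOn f (Icc a b ∩ Icc y x) < ε / 2 := hl (Iio_mem_nhds hε2)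
    have hr' : ∀ᶠ y in 𝓝[Icc a b] x, eVariationOn f (Icc a b ∩ Icc x y) < ε / 2 := hr (Iio_mem_nhds hε2)
    obtain ⟨τ, hτ, hτ'⟩ := Metric.mem_nhdsWithin_iff.1 (hl'.and hr')
    exact ⟨τ, hτ, fun y hy hyx => hτ' ⟨hyx, hy⟩⟩
  choose! τ hτ hτ' using hloc
  -- a Lebesgue number of the cover by the balls
  obtain ⟨l, hl, hleb⟩ := lebesgue_number_lemma_of_metric (isCompact_Icc (a := a) (b := b))
    (c := fun x : Icc a b => ball (x : ℝ) (τ x)) (fun x => isOpen_ball)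
    (fun x hx => mem_iUnion.2 ⟨⟨x, hx⟩, mem_ball_self (hτ x hx)⟩)
  refine ⟨l / 2, half_pos hl, fun s t hs ht hst hts => ?_⟩
  obtain ⟨⟨x, hx⟩, hball⟩ := hleb s hs
  -- both endpoints lie in the ball about `x`
  have hsx : dist s x < τ x := by simpa using hball (mem_ball_self hl)
  have htx : dist t x < τ x := by
    have : t ∈ ball s l := by rw [mem_ball, Real.dist_eq, abs_of_nonneg (by linarith)]; linarith
    simpa using hball this
  obtain ⟨hs1, hs2⟩ := hτ' x hx s hs hsx
  obtain ⟨ht1, ht2⟩ := hτ' x hx t ht htx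
  have hinter : ∀ u v, u ∈ Icc a b → v ∈ Icc a b → Icc a b ∩ Icc u v = Icc u v := fun u v hu hv =>
    inter_eq_right.2 (Icc_subset_Icc hu.1 hv.2)
  rcases le_total x s with hxs | hsx'
  · -- `x ≤ s ≤ t`
    calc eVariationOn f (Icc s t) ≤ eVariationOn f (Icc a b ∩ Icc x t) := by
          rw [hinter x t hx ht]; exact eVariationOn.mono f (Icc_subset_Icc hxs le_rfl)
      _ ≤ ε := ht2.le.trans ENNReal.half_le_self
  rcases le_total t x with htx' | hxt
  · -- `s ≤ t ≤ x`
    calc eVariationOn f (Icc s t) ≤ eVariationOn f (Icc a b ∩ Icc s x) := by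
          rw [hinter s x hs hx]; exact eVariationOn.mono f (Icc_subset_Icc le_rfl htx')
      _ ≤ ε := hs1.le.trans ENNReal.half_le_self
  · -- `s ≤ x ≤ t`
    have hsplit := eVariationOn.Icc_add_Icc f (s := Icc a b) hsx' hxt hx
    rw [hinter s t hs ht] at hsplit
    calc eVariationOn f (Icc s t) = eVariationOn f (Icc a b ∩ Icc s x) + eVariationOn f (Icc a b ∩ Icc x t) := hsplit.symm
      _ ≤ ε / 2 + ε / 2 := add_le_add hs1.le ht2.le
      _ = ε := ENNReal.add_halves ε

/-! ### Cut parameters -/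

/-- **Cut parameters**: for a continuous function of bounded variation on `[0, 1]`, a positive `η`
and a finite set `Φ` of forbidden parameters there is a finite set of parameters containing `0`
and `1`, inside `[0, 1]`, whose other members avoid `Φ`, with variation at most `η` between
consecutive members. [cite: SchrammSmirnov2011, §4, proof of Prop. 4.1 (cutting the pieces of α; formalisation device)] -/
theorem exists_cut_params {f : ℝ → ℂ} (hf : Continuous f) (hbv : BoundedVariationOn f (Icc 0 1)) {η : ℝ}
    (hη : 0 < η) {Φ : Set ℝ} (hΦ : Φ.Finite) :
    ∃ CUT : Finset ℝ, (0 : ℝ) ∈ CUT ∧ (1 : ℝ) ∈ CUT ∧ (∀ t ∈ CUT, t ∈ Icc (0 : ℝ) 1) ∧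
      (∀ t ∈ CUT, t ≠ 0 → t ≠ 1 → t ∉ Φ) ∧
      ∀ s ∈ CUT, ∀ t ∈ CUT, s < t → (∀ u ∈ CUT, ¬ (s < u ∧ u < t)) →
        eVariationOn f (Icc s t) ≤ ENNReal.ofReal η := by
  classical
  obtain ⟨l, hl, hvar⟩ := exists_forall_eVariationOn_Icc_le (a := 0) (b := 1) hf hbv
    (ENNReal.ofReal_pos.2 hη)
  -- the number of steps: `2 / N ≤ l`
  obtain ⟨N, hN⟩ : ∃ N : ℕ, 2 / l < N := exists_nat_gt _
  have hNpos : (0 : ℝ) < N := lt_trans (by positivity) hN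
  have hN1 : 1 ≤ N := by exact_mod_cast (show (0 : ℝ) < N from hNpos)
  have hstep : 2 / (N : ℝ) ≤ l := by
    rw [div_le_iff₀ hNpos]; rw [div_lt_iff₀ hl] at hN; linarith
  -- the interior parameters, perturbed off `Φ`
  have hchoice : ∀ j : ℕ, ∃ p : ℝ, p ∈ Ioo ((j : ℝ) / N) ((j : ℝ) / N + 1 / (2 * N)) ∧ p ∉ Φ := by
    intro j
    have hinf : (Ioo ((j : ℝ) / N) ((j : ℝ) / N + 1 / (2 * N)) \ Φ).Infinite :=
      (Ioo_infinite (lt_add_of_pos_right _ (by positivity))).sdiff hΦ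
    obtain ⟨p, hp, hpΦ⟩ := hinf.nonempty
    exact ⟨p, hp, hpΦ⟩
  choose q hq hqΦ using hchoice
  set p : ℕ → ℝ := fun j => if j = 0 then 0 else if N ≤ j then 1 else q j with hp
  have hp0 : p 0 = 0 := by simp [hp]
  have hpN : ∀ j, N ≤ j → p j = 1 := fun j hj => by
    have : j ≠ 0 := by omega
    simp [hp, this, hj]
  have hpmid : ∀ j, j ≠ 0 → j < N → p j = q j := fun j hj hjN => by
    simp [hp, hj, not_le.2 hjN]
  -- bounds on the parameters
  have hp_lower : ∀ j, j ≤ N → (j : ℝ) / N ≤ p j := by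
    intro j hj
    by_cases hj0 : j = 0
    · subst hj0; simp [hp0]
    rcases Nat.lt_or_ge j N with hjN | hjN
    · rw [hpmid j hj0 hjN]; exact (hq j).1.le
    · rw [hpN j hjN, div_le_one hNpos]; exact_mod_cast hj
  have hp_upper : ∀ j, j < N → p j < (j : ℝ) / N + 1 / (2 * N) := by
    intro j hjN
    by_cases hj0 : j = 0
    · subst hj0; rw [hp0]; simp; positivity
    · rw [hpmid j hj0 hjN]; exact (hq j).2
  have hp_mem : ∀ j, p j ∈ Icc (0 : ℝ) 1 := by
    intro j
    rcases Nat.lt_or_ge j N with hjN | hjN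
    · refine ⟨le_trans (by positivity) (hp_lower j hjN.le), ?_⟩
      have h1 := hp_upper j hjN
      have h2 : (j : ℝ) / N + 1 / (2 * N) ≤ 1 := by
        have hj1 : (j : ℝ) + 1 ≤ N := by exact_mod_cast hjN
        rw [div_add_div _ _ hNpos.ne' (by positivity), div_le_one (by positivity)]
        nlinarith
      linarith
    · rw [hpN j hjN]; exact ⟨zero_le_one, le_rfl⟩
  have hp_lt_succ : ∀ j, j < N → p j < p (j + 1) := by
    intro j hjN
    have h1 := hp_upper j hjN
    have h2 := hp_lower (j + 1) hjN
    have h3 : (j : ℝ) / N + 1 / (2 * N) ≤ ((j + 1 : ℕ) : ℝ) / N := by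
      rw [Nat.cast_succ, div_add_div _ _ hNpos.ne' (by positivity), div_le_div_iff₀ (by positivity) hNpos]
      nlinarith
    linarith
  have hp_succ_sub : ∀ j, j < N → p (j + 1) - p j ≤ l := by
    intro j hjN
    have h1 := hp_lower j hjN.le
    have h2 : p (j + 1) ≤ ((j + 1 : ℕ) : ℝ) / N + 1 / (2 * N) := by
      rcases Nat.lt_or_ge (j + 1) N with h | h
      · exact (hp_upper (j + 1) h).le
      · rw [hpN (j + 1) h]
        have : (N : ℝ) ≤ (j + 1 : ℕ) := by exact_mod_cast h
        rw [div_add_div _ _ hNpos.ne' (by positivity), le_div_iff₀ (by positivity)]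
        nlinarith
    have h3 : ((j + 1 : ℕ) : ℝ) / N + 1 / (2 * N) - (j : ℝ) / N = 3 / (2 * N) := by
      rw [Nat.cast_succ]; field_simp; ring
    have h4 : 3 / (2 * (N : ℝ)) ≤ l := by
      calc 3 / (2 * (N : ℝ)) ≤ 2 / N := by
            rw [div_le_div_iff₀ (by positivity) hNpos]; nlinarith
        _ ≤ l := hstep
    linarith
  -- the cut set
  refine ⟨(Finset.range (N + 1)).image p, ?_, ?_, ?_, ?_, ?_⟩
  · exact Finset.mem_image.2 ⟨0, by simp, hp0⟩
  · exact Finset.mem_image.2 ⟨N, by simp, hpN N le_rfl⟩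
  · intro t ht
    obtain ⟨j, -, rfl⟩ := Finset.mem_image.1 ht
    exact hp_mem j
  · intro t ht ht0 ht1
    obtain ⟨j, hj, rfl⟩ := Finset.mem_image.1 ht
    have hj0 : j ≠ 0 := fun h => ht0 (by rw [h, hp0])
    have hjN : j < N := by
      by_contra h; exact ht1 (hpN j (not_lt.1 h))
    rw [hpmid j hj0 hjN]; exact hqΦ j
  · intro s hs t ht hst hnone
    obtain ⟨j, hj, rfl⟩ := Finset.mem_image.1 hs
    have hjN : j < N := by
      by_contra h
      have h1 : p j = 1 := hpN j (not_lt.1 h)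
      have h2 := (hp_mem j).2
      obtain ⟨i, -, rfl⟩ := Finset.mem_image.1 ht
      have := (hp_mem i).2
      linarith
    -- the next parameter is a cut parameter above `p j`, so `t ≤ p (j+1)`
    have hnext : p (j + 1) ∈ (Finset.range (N + 1)).image p :=
      Finset.mem_image.2 ⟨j + 1, Finset.mem_range.2 (by omega), rfl⟩
    have htle : t ≤ p (j + 1) := by
      by_contra h
      exact hnone _ hnext ⟨hp_lt_succ j hjN, not_le.1 h⟩
    have htI : t ∈ Icc (0 : ℝ) 1 := by
      obtain ⟨i, -, rfl⟩ := Finset.mem_image.1 ht; exact hp_mem i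
    exact hvar _ _ (hp_mem j) htI hst.le (by have := hp_succ_sub j hjN; linarith)

end StripPieces

end Literature.Probability.Percolation

end
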